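import Mathlib.MeasureTheory.Integral.Prod
import Mathlib.MeasureTheory.Function.L2Space
import Mathlib.Analysis.InnerProductSpace.Adjoint
import Literature.Analysis.OperatorTheory.L2KernelHilbertSchmidt
import Literature.Analysis.OperatorTheory.SupNormCompactOperator
import HarnessLib

/-!
# `L²`-kernel integral operators, complex scalars, two s-finite spaces: compactness, adjoint,
# Hermitian kernels (Reed–Simon I, Thm. VI.23 with Thm. VI.22 (e)) — PROVED

Topic `Literature/Analysis/OperatorTheory`; theorems only (no definition, no named fact, no instance).
This file continues the namespace `Literature.Analysis.OperatorTheory.L2Kernel` of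
`L2KernelHilbertSchmidt.lean`, which proves, for an `RCLike 𝕜`-valued kernel `K : X → Y → 𝕜` between two
s-finite measure spaces `(X, μ)`, `(Y, ν)` with `uncurry K ∈ L²(μ ⊗ ν)`, the `L²`-theory of
`(Aφ)(x) = ∫ K(x, y) φ(y) dν(y)` (`ae_memLp_section`, `memLp_two_integral_mul`, the existence
`L2Kernel.exists_op` of a bounded `A : L²(Y, ν; 𝕜) → L²(X, μ; 𝕜)` with the a.e. kernel formula) and the
Hilbert–Schmidt IDENTITY `Σ_i ‖A e_i‖² = ∫∫ |K|²` over a countable Hilbert basis.  The companion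
`L2KernelIntegralOperator.lean` has the rest of Reed–Simon's Thm. VI.23 package — compactness,
the inner-product formula, self-adjointness for symmetric kernels — but only for REAL kernels on ONE space
(`Lp ℝ 2 μ`).  Here that remainder is proved in the complex / two-space generality, for EVERY bounded
`A` with `hA : ∀ φ, A φ =ᵐ[μ] fun x ↦ ∫ K(x, y) φ(y) dν(y)` (such an `A` is unique, `L2Kernel.op_unique`):
* `L2Kernel.sum_norm_sq_integral_mul_le`, `L2Kernel.sum_norm_sq_op_le` — row-wise Bessel and **the
  Hilbert–Schmidt bound** `∑ᵢ ‖A fᵢ‖² ≤ ∫ |K|² d(μ ⊗ ν)` over every FINITE orthonormal family (no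
  separability or countable basis needed);
* `L2Kernel.isCompactOperator_op` — **`A` is compact** (Reed–Simon I, Thm. VI.22 (e): "every `A ∈ 𝓘₂` is
  compact"; tree `isCompactOperator_of_orthonormal_sum_sq_le`);
* `L2Kernel.norm_op_apply_le`, `L2Kernel.opNorm_op_le` — `‖A‖ ≤ ‖K‖_{L²(μ ⊗ ν)}` (eq. (VI.8));
* `L2Kernel.integrable_conj_mul_mul`, `L2Kernel.inner_op_eq_integral`,
  `L2Kernel.inner_op_eq_integral_prod` — `conj ψ(x) K(x,y) φ(y) ∈ L¹(μ ⊗ ν)` and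
  `⟪ψ, Aφ⟫ = ∫ conj ψ(x) (∫ K(x,y) φ(y) dν(y)) dμ(x) = ∫ conj ψ(x) K(x,y) φ(y) d(μ ⊗ ν)`;
* `L2Kernel.memLp_conjTranspose`, `L2Kernel.adjoint_op` — the conjugate-transposed kernel
  `(y, x) ↦ conj K(x, y)` is in `L²(ν ⊗ μ)` and **the adjoint `A†` acts by it**:
  `A† ψ =ᵐ[ν] fun y ↦ ∫ conj K(x, y) ψ(x) dμ(x)`;
* `L2Kernel.isSelfAdjoint_op` — on one space, a HERMITIAN kernel `K(y, x) = conj K(x, y)` gives a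
  self-adjoint operator;
* `L2Kernel.memLp_two_of_norm_le_sum`, `L2Kernel.memLp_two_of_norm_le_mul` — a measurable kernel dominated
  a.e. by a finite sum of tensor products `Σᵢ ‖uᵢ(x)‖ ‖vᵢ(y)‖` of `L²` functions is square integrable
  (the form in which Green / Volterra kernels `u(x ∧ y) v(x ∨ y)` built from `L²` solution pairs are fed
  to the above); `L2Kernel.memLp_two_of_minmax` — the Green / Volterra shape `K(x, y) = u(x ∧ y) v(x ∨ y)`
  with `u, v ∈ L²` on a linearly ordered space, directly;
* `L2Kernel.integral_minmax_mul`, `L2Kernel.integral_minmax_mul_of_memLp`, `L2Kernel.op_apply_minmax` — the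
  action of such a min/max kernel splits into the two one-sided (Volterra) integrals
  `(Aφ)(x) = v(x) ∫_{y ≤ x} u φ + u(x) ∫_{x < y} v φ` (every `x` for the integral; a.e. for `A`);
* `L2Kernel.exists_op_package` — existence plus all of the above in one statement.
Written for the cell `rh-crit` (Connes–Moscovici 2022 Thm. 1.6 (iv), "`W_sa` has compact resolvent": the
resolvent is an `L²`-kernel operator plus a finite-rank one on `L²(ℝ; ℂ)`); RH-free abstract operator
theory.

## References
* M. Reed, B. Simon, *Methods of Modern Mathematical Physics I: Functional Analysis* (1972), §VI.6,
  Thm. VI.22 (e) and Thm. VI.23 with its proof, eq. (VI.8) (PDF pp. 198–199 of the held copy). [ReedSimon1972]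
-/

noncomputable section

open MeasureTheory Function Filter
open scoped ENNReal InnerProductSpace ComplexConjugate

namespace Literature.Analysis.OperatorTheory

namespace L2Kernel

variable {X Y : Type*} [MeasurableSpace Y] {ν : Measure Y} {𝕜 : Type*} [RCLike 𝕜] {K : X → Y → 𝕜}

/-! ### Row-wise Bessel inequality -/

/-- **Row-wise Bessel inequality**: for a finite orthonormal family `(fᵢ)` of `L²(Y, ν)` and a point `x`
with `K(x, ·) ∈ L²`, `∑ᵢ |∫ K(x, y) fᵢ(y) dν(y)|² ≤ ∫ |K(x, y)|² dν(y)` (Bessel for the vector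
`conj K(x, ·)`, whose inner product with `φ` is `(Aφ)(x)`). [cite: ReedSimon1972, Thm. VI.23 (proof), PDF p. 199] -/
theorem sum_norm_sq_integral_mul_le {x : X} (hx : MemLp (K x) 2 ν) {m : ℕ} {f : Fin m → Lp 𝕜 2 ν}
    (hf : Orthonormal 𝕜 f) : ∑ i, ‖∫ y, K x y * f i y ∂ν‖ ^ 2 ≤ ∫ y, ‖K x y‖ ^ 2 ∂ν := by
  rw [← norm_toLp_conj_section_sq hx]
  have h := hf.sum_inner_products_le ((memLp_two_conj_section hx).toLp _) (s := Finset.univ)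
  refine le_trans (le_of_eq (Finset.sum_congr rfl fun i _ => ?_)) h
  rw [integral_mul_eq_inner hx, ← inner_conj_symm, RCLike.norm_conj]

variable [MeasurableSpace X] {μ : Measure X}

/-! ### Uniqueness, tensor products, the inner-product formula -/

/-- Two bounded operators acting a.e. by the same kernel formula are equal (`Lp.ext`). [cite: ReedSimon1972, Thm. VI.23, PDF pp. 198–199] -/
theorem op_unique {A B : Lp 𝕜 2 ν →L[𝕜] Lp 𝕜 2 μ}
    (hA : ∀ φ : Lp 𝕜 2 ν, (A φ : X → 𝕜) =ᵐ[μ] fun x => ∫ y, K x y * φ y ∂ν)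
    (hB : ∀ φ : Lp 𝕜 2 ν, (B φ : X → 𝕜) =ᵐ[μ] fun x => ∫ y, K x y * φ y ∂ν) : A = B :=
  ContinuousLinearMap.ext fun φ => Lp.ext ((hA φ).trans (hB φ).symm)

/-- `ψ ⊗ φ ∈ L²(μ ⊗ ν)` for `ψ ∈ L²(μ)`, `φ ∈ L²(ν)`. [cite: ReedSimon1972, Thm. VI.23 (proof), PDF p. 199] -/
theorem memLp_two_tensor {ψ : X → 𝕜} {φ : Y → 𝕜} (hψ : MemLp ψ 2 μ) (hφ : MemLp φ 2 ν) :
    MemLp (fun z : X × Y => ψ z.1 * φ z.2) 2 (μ.prod ν) := by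
  have hmeas : AEStronglyMeasurable (fun z : X × Y => ψ z.1 * φ z.2) (μ.prod ν) :=
    hψ.1.comp_fst.mul hφ.1.comp_snd
  rw [memLp_two_iff_integrable_sq_norm hmeas]
  refine (integrable_norm_sq_mul_norm_sq hψ hφ).congr (Eventually.of_forall fun z => ?_)
  simp only [norm_mul, mul_pow]

/-- The conjugate `x ↦ conj ψ(x)` of an `L²` function is in `L²` (plumbing for the integrand
`conj ψ ⊗ φ` of Reed–Simon's proof). [cite: ReedSimon1972, Thm. VI.23 (proof), PDF p. 199] -/
theorem memLp_two_conj {ψ : X → 𝕜} (hψ : MemLp ψ 2 μ) : MemLp (fun x => conj (ψ x)) 2 μ :=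
  hψ.of_le (RCLike.continuous_conj.comp_aestronglyMeasurable hψ.1)
    (Eventually.of_forall fun x => (RCLike.norm_conj (ψ x)).le)

/-- The double integrand `conj ψ(x) K(x, y) φ(y)` is integrable on `μ ⊗ ν` (`K` and `conj ψ ⊗ φ` are both
in `L²(μ ⊗ ν)`). [cite: ReedSimon1972, Thm. VI.23 (proof), PDF p. 199] -/
theorem integrable_conj_mul_mul (hK : MemLp (uncurry K) 2 (μ.prod ν)) (ψ : Lp 𝕜 2 μ) (φ : Lp 𝕜 2 ν) :
    Integrable (fun z : X × Y => conj (ψ z.1) * (K z.1 z.2 * φ z.2)) (μ.prod ν) := by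
  have h := hK.integrable_mul (memLp_two_tensor (memLp_two_conj (Lp.memLp ψ)) (Lp.memLp φ))
  refine h.congr (Eventually.of_forall fun z => ?_)
  simp only [Pi.mul_apply, uncurry]
  ring

/-- **The inner-product formula** `⟪ψ, Aφ⟫ = ∫ conj ψ(x) (∫ K(x, y) φ(y) dν(y)) dμ(x)`, for any bounded `A`
acting a.e. by the kernel (no integrability hypothesis on `K` is needed for this identity).
[cite: ReedSimon1972, Thm. VI.23, PDF pp. 198–199] -/
theorem inner_op_eq_integral {A : Lp 𝕜 2 ν →L[𝕜] Lp 𝕜 2 μ}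
    (hA : ∀ φ : Lp 𝕜 2 ν, (A φ : X → 𝕜) =ᵐ[μ] fun x => ∫ y, K x y * φ y ∂ν)
    (ψ : Lp 𝕜 2 μ) (φ : Lp 𝕜 2 ν) :
    ⟪ψ, A φ⟫_𝕜 = ∫ x, conj (ψ x) * ∫ y, K x y * φ y ∂ν ∂μ := by
  rw [L2.inner_def]
  refine integral_congr_ae ?_
  filter_upwards [hA φ] with x hx
  rw [hx, RCLike.inner_apply']

variable [SFinite ν]

/-- The inner-product formula as ONE integral over the product: `⟪ψ, Aφ⟫ = ∫ conj ψ(x) K(x,y) φ(y) d(μ ⊗ ν)`.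
[cite: ReedSimon1972, Thm. VI.23, PDF pp. 198–199] -/
theorem inner_op_eq_integral_prod [SFinite μ] (hK : MemLp (uncurry K) 2 (μ.prod ν))
    {A : Lp 𝕜 2 ν →L[𝕜] Lp 𝕜 2 μ}
    (hA : ∀ φ : Lp 𝕜 2 ν, (A φ : X → 𝕜) =ᵐ[μ] fun x => ∫ y, K x y * φ y ∂ν)
    (ψ : Lp 𝕜 2 μ) (φ : Lp 𝕜 2 ν) :
    ⟪ψ, A φ⟫_𝕜 = ∫ z, conj (ψ z.1) * (K z.1 z.2 * φ z.2) ∂(μ.prod ν) := by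
  rw [inner_op_eq_integral hA, integral_prod _ (integrable_conj_mul_mul hK ψ φ)]
  refine integral_congr_ae (Eventually.of_forall fun x => ?_)
  exact (integral_const_mul _ _).symm

/-! ### The Hilbert–Schmidt bound and compactness -/

variable [SFinite μ]

/-- `A φ` is the `L²` class of `x ↦ ∫ K(x, y) φ(y) dν(y)`. [cite: ReedSimon1972, Thm. VI.23, PDF pp. 198–199] -/
theorem op_apply_eq_toLp (hK : MemLp (uncurry K) 2 (μ.prod ν)) {A : Lp 𝕜 2 ν →L[𝕜] Lp 𝕜 2 μ}
    (hA : ∀ φ : Lp 𝕜 2 ν, (A φ : X → 𝕜) =ᵐ[μ] fun x => ∫ y, K x y * φ y ∂ν) (φ : Lp 𝕜 2 ν) :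
    A φ = (memLp_two_integral_mul hK φ).toLp _ :=
  Lp.ext ((hA φ).trans (memLp_two_integral_mul hK φ).coeFn_toLp.symm)

/-- **`‖Aφ‖ ≤ ‖K‖_{L²(μ ⊗ ν)} ‖φ‖`** (Reed–Simon I, eq. (VI.8)). [cite: ReedSimon1972, Thm. VI.23 eq. (VI.8), PDF p. 199] -/
theorem norm_op_apply_le (hK : MemLp (uncurry K) 2 (μ.prod ν)) {A : Lp 𝕜 2 ν →L[𝕜] Lp 𝕜 2 μ}
    (hA : ∀ φ : Lp 𝕜 2 ν, (A φ : X → 𝕜) =ᵐ[μ] fun x => ∫ y, K x y * φ y ∂ν) (φ : Lp 𝕜 2 ν) :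
    ‖A φ‖ ≤ Real.sqrt (∫ z, ‖uncurry K z‖ ^ 2 ∂(μ.prod ν)) * ‖φ‖ := by
  rw [op_apply_eq_toLp hK hA φ]
  exact norm_toLp_integral_mul_le hK φ

/-- **`‖A‖ ≤ ‖K‖_{L²(μ ⊗ ν)}`** (Reed–Simon I, Thm. VI.22 (d) `‖A‖ ≤ ‖A‖₂` with Thm. VI.23).
[cite: ReedSimon1972, Thm. VI.23 eq. (VI.8), PDF p. 199] -/
theorem opNorm_op_le (hK : MemLp (uncurry K) 2 (μ.prod ν)) {A : Lp 𝕜 2 ν →L[𝕜] Lp 𝕜 2 μ}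
    (hA : ∀ φ : Lp 𝕜 2 ν, (A φ : X → 𝕜) =ᵐ[μ] fun x => ∫ y, K x y * φ y ∂ν) :
    ‖A‖ ≤ Real.sqrt (∫ z, ‖uncurry K z‖ ^ 2 ∂(μ.prod ν)) :=
  ContinuousLinearMap.opNorm_le_bound _ (Real.sqrt_nonneg _) (norm_op_apply_le hK hA)

/-- **The Hilbert–Schmidt bound** (Reed–Simon I, Thm. VI.23, `‖A‖²_{HS} = ∫∫ |K|²`, in the finite form
that needs no countable basis): for every finite orthonormal family `(fᵢ)` of `L²(Y, ν)`,
`∑ᵢ ‖A fᵢ‖² ≤ ∫ |K|² d(μ ⊗ ν)` — row-wise Bessel integrated over `x`. [cite: ReedSimon1972, Thm. VI.23, PDF pp. 198–199] -/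
theorem sum_norm_sq_op_le (hK : MemLp (uncurry K) 2 (μ.prod ν)) {A : Lp 𝕜 2 ν →L[𝕜] Lp 𝕜 2 μ}
    (hA : ∀ φ : Lp 𝕜 2 ν, (A φ : X → 𝕜) =ᵐ[μ] fun x => ∫ y, K x y * φ y ∂ν)
    {m : ℕ} {f : Fin m → Lp 𝕜 2 ν} (hf : Orthonormal 𝕜 f) :
    ∑ i, ‖A (f i)‖ ^ 2 ≤ ∫ z, ‖uncurry K z‖ ^ 2 ∂(μ.prod ν) := by
  have hsq : ∀ i, ‖A (f i)‖ ^ 2 = ∫ x, ‖∫ y, K x y * f i y ∂ν‖ ^ 2 ∂μ := fun i => by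
    rw [op_apply_eq_toLp hK hA (f i), norm_toLp_sq_eq_integral_norm_sq]
  have hint : ∀ i, Integrable (fun x => ‖∫ y, K x y * f i y ∂ν‖ ^ 2) μ := fun i =>
    (memLp_two_iff_integrable_sq_norm (aestronglyMeasurable_integral_mul hK.1 (f i))).1
      (memLp_two_integral_mul hK (f i))
  simp only [hsq]
  rw [← integral_finsetSum _ fun i _ => hint i, ← integral_integral_norm_sq hK]
  refine integral_mono_ae (integrable_finsetSum _ fun i _ => hint i)
    (integrable_integral_norm_sq hK) ?_
  filter_upwards [ae_memLp_section hK] with x hx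
  simpa only [Finset.sum_apply] using sum_norm_sq_integral_mul_le hx hf

/-- **Compactness of `L²`-kernel operators** (Reed–Simon I, Thm. VI.22 (e) "every `A ∈ 𝓘₂` is compact",
with Thm. VI.23): any bounded `A : L²(Y, ν) → L²(X, μ)` acting a.e. by a square-integrable kernel is a
compact operator (bounded Hilbert–Schmidt sums over finite orthonormal families, tree
`isCompactOperator_of_orthonormal_sum_sq_le`). [cite: ReedSimon1972, Thm. VI.22 (e) and Thm. VI.23, PDF pp. 198–199] -/
theorem isCompactOperator_op (hK : MemLp (uncurry K) 2 (μ.prod ν)) {A : Lp 𝕜 2 ν →L[𝕜] Lp 𝕜 2 μ}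
    (hA : ∀ φ : Lp 𝕜 2 ν, (A φ : X → 𝕜) =ᵐ[μ] fun x => ∫ y, K x y * φ y ∂ν) :
    IsCompactOperator A :=
  isCompactOperator_of_orthonormal_sum_sq_le A fun _ _ hf => sum_norm_sq_op_le hK hA hf

/-! ### The adjoint and Hermitian kernels -/

/-- The conjugate-transposed kernel `(y, x) ↦ conj K(x, y)` is square integrable on `ν ⊗ μ`.
[cite: ReedSimon1972, Thm. VI.22 (d) and Thm. VI.23, PDF pp. 198–199] -/
theorem memLp_conjTranspose (hK : MemLp (uncurry K) 2 (μ.prod ν)) :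
    MemLp (uncurry fun y x => conj (K x y)) 2 (ν.prod μ) := by
  have h1 : AEStronglyMeasurable (uncurry fun y x => conj (K x y)) (ν.prod μ) :=
    (RCLike.continuous_conj.comp_aestronglyMeasurable hK.1).prod_swap
  rw [memLp_two_iff_integrable_sq_norm h1]
  refine ((memLp_two_iff_integrable_sq_norm hK.1).1 hK).swap.congr (Eventually.of_forall fun z => ?_)
  simp only [comp_apply, uncurry, Prod.swap, RCLike.norm_conj]

/-- **The adjoint of an `L²`-kernel operator is the kernel operator of the conjugate-transposed kernel**:
`(A† ψ)(y) = ∫ conj K(x, y) ψ(x) dμ(x)` for `ν`-a.e. `y` (Fubini on `conj ψ(x) K(x,y) φ(y) ∈ L¹(μ ⊗ ν)`).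
[cite: ReedSimon1972, Thm. VI.22 (d) and Thm. VI.23, PDF pp. 198–199] -/
theorem adjoint_op (hK : MemLp (uncurry K) 2 (μ.prod ν)) {A : Lp 𝕜 2 ν →L[𝕜] Lp 𝕜 2 μ}
    (hA : ∀ φ : Lp 𝕜 2 ν, (A φ : X → 𝕜) =ᵐ[μ] fun x => ∫ y, K x y * φ y ∂ν) (ψ : Lp 𝕜 2 μ) :
    (ContinuousLinearMap.adjoint A ψ : Y → 𝕜) =ᵐ[ν] fun y => ∫ x, conj (K x y) * ψ x ∂μ := by
  obtain ⟨B, hB⟩ := exists_op (memLp_conjTranspose hK)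
  have hAB : ContinuousLinearMap.adjoint A = B := by
    symm
    rw [ContinuousLinearMap.eq_adjoint_iff]
    intro ψ φ
    -- `⟪B ψ, φ⟫ = conj ⟪φ, B ψ⟫ = conj ∫ conj φ(y) ∫ conj K(x,y) ψ(x) = ∫∫ conj ψ(x) K(x,y) φ(y)`
    rw [← inner_conj_symm, inner_op_eq_integral_prod (memLp_conjTranspose hK) hB φ ψ,
      ← integral_conj, inner_op_eq_integral_prod hK hA ψ φ,
      ← integral_prod_swap]
    refine integral_congr_ae (Eventually.of_forall fun z => ?_)
    simp only [Prod.swap, map_mul, RCLike.conj_conj]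
    ring
  rw [hAB]
  exact hB ψ

/-- **Hermitian kernels give self-adjoint operators**: on one space, if `K(y, x) = conj K(x, y)` for all
`x, y`, then any bounded `A` acting a.e. by `K` is self-adjoint (`A†` acts by the same kernel, and the
operator with a given kernel is unique). [cite: ReedSimon1972, Thm. VI.23, PDF pp. 198–199] -/
theorem isSelfAdjoint_op {K : X → X → 𝕜} (hK : MemLp (uncurry K) 2 (μ.prod μ))
    (hherm : ∀ x y, K y x = conj (K x y)) {A : Lp 𝕜 2 μ →L[𝕜] Lp 𝕜 2 μ}
    (hA : ∀ φ : Lp 𝕜 2 μ, (A φ : X → 𝕜) =ᵐ[μ] fun x => ∫ y, K x y * φ y ∂μ) : IsSelfAdjoint A := by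
  rw [ContinuousLinearMap.isSelfAdjoint_iff']
  refine op_unique (K := K) (fun φ => ?_) hA
  filter_upwards [adjoint_op hK hA φ] with y hy
  rw [hy]
  refine integral_congr_ae (Eventually.of_forall fun x => ?_)
  dsimp only
  rw [hherm x y]

/-! ### Square-integrability of dominated kernels -/

omit [SFinite ν] [SFinite μ] in
/-- **`L²`-domination criterion**: an a.e.-strongly measurable kernel dominated `μ ⊗ ν`-a.e. by a finite
sum of tensor products `Σᵢ ‖uᵢ(x)‖ ‖vᵢ(y)‖` with `uᵢ ∈ L²(μ)`, `vᵢ ∈ L²(ν)` is square integrable on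
`μ ⊗ ν` (so everything above applies to it; e.g. Green / Volterra kernels `u(x ∧ y) v(x ∨ y)` of `L²`
solution pairs, dominated by `|u(x)||v(y)| + |v(x)||u(y)|`); this is the form in which the hypothesis
`K ∈ L²(M × M, dμ ⊗ dμ)` of Reed–Simon's Thm. VI.23 is verified in practice. [cite: ReedSimon1972, Thm. VI.23 (hypothesis `K ∈ L²(M × M, dμ ⊗ dμ)`), PDF p. 198] -/
theorem memLp_two_of_norm_le_sum {ι : Type*} {s : Finset ι} {E F : Type*} [NormedAddCommGroup E]
    [NormedAddCommGroup F] {u : ι → X → E} {v : ι → Y → F}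
    (hKm : AEStronglyMeasurable (uncurry K) (μ.prod ν))
    (hu : ∀ i ∈ s, MemLp (u i) 2 μ) (hv : ∀ i ∈ s, MemLp (v i) 2 ν)
    (hdom : ∀ᵐ z ∂(μ.prod ν), ‖uncurry K z‖ ≤ ∑ i ∈ s, ‖u i z.1‖ * ‖v i z.2‖) :
    MemLp (uncurry K) 2 (μ.prod ν) := by
  have hg : MemLp (fun z : X × Y => ∑ i ∈ s, ‖u i z.1‖ * ‖v i z.2‖) 2 (μ.prod ν) := by
    refine memLp_finsetSum (ε' := ℝ) s (f := fun i (z : X × Y) => ‖u i z.1‖ * ‖v i z.2‖)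
      fun i hi => ?_
    exact memLp_two_tensor (𝕜 := ℝ) (hu i hi).norm (hv i hi).norm
  refine hg.of_le hKm (hdom.mono fun z hz => hz.trans ?_)
  exact Real.le_norm_self _

omit [SFinite ν] [SFinite μ] in
/-- The one-term case: `‖K(x, y)‖ ≤ ‖u(x)‖ ‖v(y)‖` a.e. with `u ∈ L²(μ)`, `v ∈ L²(ν)` implies
`uncurry K ∈ L²(μ ⊗ ν)` (verification of the hypothesis of Reed–Simon's Thm. VI.23). [cite: ReedSimon1972, Thm. VI.23 (hypothesis `K ∈ L²(M × M, dμ ⊗ dμ)`), PDF p. 198] -/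
theorem memLp_two_of_norm_le_mul {E F : Type*} [NormedAddCommGroup E] [NormedAddCommGroup F]
    {u : X → E} {v : Y → F} (hKm : AEStronglyMeasurable (uncurry K) (μ.prod ν))
    (hu : MemLp u 2 μ) (hv : MemLp v 2 ν)
    (hdom : ∀ᵐ z ∂(μ.prod ν), ‖uncurry K z‖ ≤ ‖u z.1‖ * ‖v z.2‖) :
    MemLp (uncurry K) 2 (μ.prod ν) :=
  memLp_two_of_norm_le_sum (s := (Finset.univ : Finset Unit)) (u := fun _ => u) (v := fun _ => v) hKm
    (fun _ _ => hu) (fun _ _ => hv) (by simpa only [Finset.univ_unique, Finset.sum_singleton] using hdom)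

/-- **Green / Volterra kernels of `L²` pairs are square integrable**: on a linearly ordered space, a
kernel with `K(x, y) = u(y) v(x)` for `y ≤ x` and `K(x, y) = u(x) v(y)` for `x < y` — i.e.
`K(x, y) = u(x ∧ y) v(x ∨ y)`, the shape of the Green's function of a Sturm–Liouville operator built from a
solution pair — with `u, v ∈ L²(τ)` satisfies `uncurry K ∈ L²(τ ⊗ τ)` (dominated by
`|v(x)||u(y)| + |u(x)||v(y)|`; verification of the hypothesis of Reed–Simon's Thm. VI.23). [cite: ReedSimon1972, Thm. VI.23 (hypothesis `K ∈ L²(M × M, dμ ⊗ dμ)`), PDF p. 198] -/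
theorem memLp_two_of_minmax {T : Type*} [MeasurableSpace T] [TopologicalSpace T] [LinearOrder T]
    [OrderClosedTopology T] [SecondCountableTopology T] [OpensMeasurableSpace T] {τ : Measure T}
    {K : T → T → 𝕜} {u v : T → 𝕜} (hu : MemLp u 2 τ) (hv : MemLp v 2 τ)
    (h₁ : ∀ x y, y ≤ x → K x y = u y * v x) (h₂ : ∀ x y, x < y → K x y = u x * v y) :
    MemLp (uncurry K) 2 (τ.prod τ) := by
  classical
  set s : Set (T × T) := {z | z.2 ≤ z.1} with hs_def
  have hs : MeasurableSet s := measurableSet_le measurable_snd measurable_fst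
  have hKeq : uncurry K = s.piecewise (fun z => u z.2 * v z.1) (fun z => u z.1 * v z.2) := by
    funext z
    by_cases hz : z.2 ≤ z.1
    · rw [Set.piecewise_eq_of_mem _ _ _ (show z ∈ s from hz)]
      exact h₁ _ _ hz
    · rw [Set.piecewise_eq_of_notMem _ _ _ (show z ∉ s from hz)]
      exact h₂ _ _ (not_le.1 hz)
  have hmeas : AEStronglyMeasurable (uncurry K) (τ.prod τ) := by
    rw [hKeq]
    exact AEStronglyMeasurable.piecewise hs (hu.1.comp_snd.mul hv.1.comp_fst).restrict
      (hu.1.comp_fst.mul hv.1.comp_snd).restrict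
  refine ((memLp_two_tensor hv hu).norm.add (memLp_two_tensor hu hv).norm).of_le hmeas
    (Eventually.of_forall fun z => ?_)
  rw [Pi.add_apply, Real.norm_of_nonneg (add_nonneg (norm_nonneg _) (norm_nonneg _))]
  by_cases hz : z.2 ≤ z.1
  · rw [show uncurry K z = u z.2 * v z.1 from h₁ _ _ hz, mul_comm]
    exact le_add_of_nonneg_right (norm_nonneg _)
  · rw [show uncurry K z = u z.1 * v z.2 from h₂ _ _ (not_le.1 hz)]
    exact le_add_of_nonneg_left (norm_nonneg _)

/-! ### The action of a Green / Volterra kernel: one-sided splitting -/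

/-- **The action of a min/max kernel splits into two one-sided integrals** (the Volterra / variation of
parameters form of the Green's operator): if `K(x, y) = u(y) v(x)` for `y ≤ x` and `K(x, y) = u(x) v(y)` for
`x < y`, and `u f`, `v f` are integrable, then for EVERY `x`,
`∫ K(x, y) f(y) dτ(y) = v(x) ∫_{y ≤ x} u(y) f(y) dτ(y) + u(x) ∫_{x < y} v(y) f(y) dτ(y)`.
[cite: ReedSimon1972, Thm. VI.23 (the kernel formula `(Af)(x) = ∫ K(x,y) f(y) dμ(y)`), PDF p. 198] -/
theorem integral_minmax_mul {T : Type*} [MeasurableSpace T] [TopologicalSpace T] [LinearOrder T]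
    [OrderClosedTopology T] [OpensMeasurableSpace T] {τ : Measure T} {K : T → T → 𝕜} {u v f : T → 𝕜}
    (huf : Integrable (fun y => u y * f y) τ) (hvf : Integrable (fun y => v y * f y) τ)
    (h₁ : ∀ x y, y ≤ x → K x y = u y * v x) (h₂ : ∀ x y, x < y → K x y = u x * v y) (x : T) :
    ∫ y, K x y * f y ∂τ =
      v x * ∫ y in Set.Iic x, u y * f y ∂τ + u x * ∫ y in Set.Ioi x, v y * f y ∂τ := by
  classical
  have hK : (fun y => K x y * f y) =
      (Set.Iic x).piecewise (fun y => v x * (u y * f y)) (fun y => u x * (v y * f y)) := by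
    funext y
    by_cases hy : y ≤ x
    · rw [Set.piecewise_eq_of_mem _ _ _ (show y ∈ Set.Iic x from hy), h₁ x y hy]
      ring
    · rw [Set.piecewise_eq_of_notMem _ _ _ (show y ∉ Set.Iic x from hy), h₂ x y (not_le.1 hy)]
      ring
  rw [hK, integral_piecewise measurableSet_Iic (huf.const_mul _).integrableOn
      (hvf.const_mul _).integrableOn, Set.compl_Iic, integral_const_mul, integral_const_mul]

/-- The same under `L²` hypotheses: `u, v, f ∈ L²(τ)`. [cite: ReedSimon1972, Thm. VI.23 (the kernel formula `(Af)(x) = ∫ K(x,y) f(y) dμ(y)`), PDF p. 198] -/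
theorem integral_minmax_mul_of_memLp {T : Type*} [MeasurableSpace T] [TopologicalSpace T]
    [LinearOrder T] [OrderClosedTopology T] [OpensMeasurableSpace T] {τ : Measure T}
    {K : T → T → 𝕜} {u v f : T → 𝕜} (hu : MemLp u 2 τ) (hv : MemLp v 2 τ) (hf : MemLp f 2 τ)
    (h₁ : ∀ x y, y ≤ x → K x y = u y * v x) (h₂ : ∀ x y, x < y → K x y = u x * v y) (x : T) :
    ∫ y, K x y * f y ∂τ =
      v x * ∫ y in Set.Iic x, u y * f y ∂τ + u x * ∫ y in Set.Ioi x, v y * f y ∂τ :=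
  integral_minmax_mul (hu.integrable_mul hf) (hv.integrable_mul hf) h₁ h₂ x

/-- **The Green / Volterra operator, a.e. form**: any bounded `A` on `L²(τ)` acting a.e. by a min/max
kernel with `u, v ∈ L²(τ)` satisfies
`(Aφ)(x) = v(x) ∫_{y ≤ x} u(y) φ(y) dτ(y) + u(x) ∫_{x < y} v(y) φ(y) dτ(y)` for a.e. `x` — the form that is
differentiated when checking that `A` is a right inverse of a Sturm–Liouville operator.
[cite: ReedSimon1972, Thm. VI.23 (the kernel formula `(Af)(x) = ∫ K(x,y) f(y) dμ(y)`), PDF p. 198] -/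
theorem op_apply_minmax {T : Type*} [MeasurableSpace T] [TopologicalSpace T] [LinearOrder T]
    [OrderClosedTopology T] [OpensMeasurableSpace T] {τ : Measure T} {K : T → T → 𝕜} {u v : T → 𝕜}
    {A : Lp 𝕜 2 τ →L[𝕜] Lp 𝕜 2 τ}
    (hA : ∀ φ : Lp 𝕜 2 τ, (A φ : T → 𝕜) =ᵐ[τ] fun x => ∫ y, K x y * φ y ∂τ)
    (hu : MemLp u 2 τ) (hv : MemLp v 2 τ)
    (h₁ : ∀ x y, y ≤ x → K x y = u y * v x) (h₂ : ∀ x y, x < y → K x y = u x * v y) (φ : Lp 𝕜 2 τ) :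
    (A φ : T → 𝕜) =ᵐ[τ] fun x =>
      v x * ∫ y in Set.Iic x, u y * φ y ∂τ + u x * ∫ y in Set.Ioi x, v y * φ y ∂τ := by
  filter_upwards [hA φ] with x hx
  rw [hx]
  exact integral_minmax_mul_of_memLp hu hv (Lp.memLp φ) h₁ h₂ x

/-! ### The package -/

/-- **Integral operators with square-integrable kernels, complex scalars, two s-finite spaces**
(Reed–Simon I, Thm. VI.23 with Thm. VI.22 (e)), the package: for `uncurry K ∈ L²(μ ⊗ ν)` there is a
bounded `A : L²(Y, ν; 𝕜) → L²(X, μ; 𝕜)` with `(Aφ)(x) = ∫ K(x,y) φ(y) dν(y)` a.e., and EVERY bounded `A`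
with this a.e. characterisation is compact, has operator norm `≤ ‖K‖_{L²}`, satisfies the Hilbert–Schmidt
bound over finite orthonormal families and the inner-product formula, and has adjoint acting by the
conjugate-transposed kernel. [cite: ReedSimon1972, Thm. VI.22 (e) and Thm. VI.23, PDF pp. 198–199] -/
theorem exists_op_package (hK : MemLp (uncurry K) 2 (μ.prod ν)) :
    (∃ A : Lp 𝕜 2 ν →L[𝕜] Lp 𝕜 2 μ,
      ∀ φ : Lp 𝕜 2 ν, (A φ : X → 𝕜) =ᵐ[μ] fun x => ∫ y, K x y * φ y ∂ν) ∧
    (∀ A : Lp 𝕜 2 ν →L[𝕜] Lp 𝕜 2 μ,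
      (∀ φ : Lp 𝕜 2 ν, (A φ : X → 𝕜) =ᵐ[μ] fun x => ∫ y, K x y * φ y ∂ν) →
      IsCompactOperator A ∧
      ‖A‖ ≤ Real.sqrt (∫ z, ‖uncurry K z‖ ^ 2 ∂(μ.prod ν)) ∧
      (∀ (m : ℕ) (f : Fin m → Lp 𝕜 2 ν), Orthonormal 𝕜 f →
        ∑ i, ‖A (f i)‖ ^ 2 ≤ ∫ z, ‖uncurry K z‖ ^ 2 ∂(μ.prod ν)) ∧
      (∀ (ψ : Lp 𝕜 2 μ) (φ : Lp 𝕜 2 ν), ⟪ψ, A φ⟫_𝕜 = ∫ x, conj (ψ x) * ∫ y, K x y * φ y ∂ν ∂μ) ∧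
      (∀ ψ : Lp 𝕜 2 μ, (ContinuousLinearMap.adjoint A ψ : Y → 𝕜) =ᵐ[ν]
        fun y => ∫ x, conj (K x y) * ψ x ∂μ)) :=
  ⟨exists_op hK, fun _ hA =>
    ⟨isCompactOperator_op hK hA, opNorm_op_le hK hA, fun _ _ hf => sum_norm_sq_op_le hK hA hf,
      fun ψ φ => inner_op_eq_integral hA ψ φ, fun ψ => adjoint_op hK hA ψ⟩⟩

end L2Kernel

end Literature.Analysis.OperatorTheory

end
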